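import Literature.MathematicalPhysics.QuantumFieldTheory.Balaban1983to89.B6Prop25Grad2DecayTwoScaleV1
import Literature.MathematicalPhysics.QuantumFieldTheory.Balaban1983to89.B6L2BlockGlobalNorm

/-!
# `Balaban1983to89.B6Prop25GlobalL2Grad2TwoScaleV1` — T. Bałaban, *Propagators and renormalization transformations for lattice gauge theories. II*,
# Commun. Math. Phys. **96** (1984) 223–250 [Balaban1984PropagatorsII], PROPOSITION 2.5 p. 246 with [Balaban1984PropagatorsI] PROPOSITION 1.1 (1.89)
# p. 33: THE GLOBAL `ℓ²` MEMBERS `‖∇∇GJ‖ ≤ C‖J‖` AND `‖G∇*∇*J‖ ≤ C‖J‖` FOR THE GENUINE TWO-SCALE `G = Δ_a⁻¹` OF (2.90), `Λ′` arbitrary, `tsV1` at the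
# paper's scaling — file 29 of the unit's `ℓ²` programme (file 27's two-scale (1.114) members, file 23b's block Schur test)

statement-level skeleton of published theorems with citation tags; proofs where landed; nothing here is a claim about the Yang–Mills mass gap

[4] p. 33 [PDF 17] (Proposition 1.1, verbatim; ×2 render `…/1984-cmp95-propagators-rt-I/…-p017-x2.png` re-read 2026-08-22, v1.1): *"Proposition 1.1.
The operator G is a symmetric operator on L²(T_η) and ‖GJ‖, ‖∇GJ‖, ‖G∇*J‖, ‖∇G∇*J‖, ‖∇∇GJ‖, ‖G∇*∇*J‖ ≦ γ₀⁻¹‖J‖, (1.89) with a positive constant γ₀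
independent of k, T_η, and depending on d only (if we put a = 1)."*; [B6] p. 246: *"The operator G … satisfies all the inequalities (1.110)–(1.114)
of the Proposition 1.2"* — and (1.114) with its factor `e^{−δ₀|y−y′|}` summed over the blocks gives the (1.89)-shaped global bound `‖·‖ ≤ C‖J‖` (our
constant `C` in place of print's `γ₀⁻¹`; file 23b's `norm_apply_le_of_l2blk`).

WHAT THIS FILE DOES: **`prop25_ineq189_gradgrad`** — `∃ C ≥ 0` (on `d, L, a₀, a₁`) with `‖∇_λ∇_μGJ‖ ≤ C‖J‖` for every volume, `j + 1 ≤ m + K`,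
`Λ′`, weights `a₀n^{d+1} ≤ w ≤ a₁n^{d+1}`, directions `λ, μ` and EVERY fine bond field `J` (no support condition) — file 27's `l2blk_DDG_scaling` and
file 23b; **`prop25_ineq189_GDadjDadj`** — `‖G∇_μ*∇_λ*J‖ ≤ C‖J‖` (adjunction, file 27's `adjoint_DDG_eq`).  With gen 13's members 1–4 (`B6Prop25GlobalGradL2TwoScaleV1`)
all six global members of (1.89) are formal for the two-scale `G` (member 4 `‖∇G∇*J‖` also by the sequel file 28b).  IMPORTS BY NAME; THEOREMS ONLY;
standard axioms.  HONEST SCOPE: per pair `(λ, μ)`; constants ours (they depend on `d, L, a₀, a₁`; print's `γ₀⁻¹` of (1.89) depends on `d` only at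
`a = 1`); NOT summit progress.  Unit `lit-balaban-p22` (gen 16), 2026-08-22.  v1.1 (gen 17, DOCSTRING-ONLY, declarations byte-identical): the
quotation of Proposition 1.1 (1.89) made verbatim and the «d and M only» misattribution removed — referee ref-4 g53 note S-B6-g53-1.
-/

noncomputable section

open scoped InnerProductSpace BigOperators Matrix
open Finset

namespace Literature.MathematicalPhysics.QuantumFieldTheory.Balaban1983to89.B6Prop25GlobalL2Grad2TwoScaleV1

open LatticeFieldCalculus B5SectBStatements B5Eq117TorusCarriers B6SectADomainsV1 B6SectAOperatorsV1 B6SectAVectorModelV1 B6SectCOperators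
  B6SectCTwoScaleV1 B6SectCTwoScaleV1Lattice B5Eq118OneStroke
open BalabanImbrieJaffe1984to88.BIJ85AxialPropagator411 (BondSpace)
open B4Sect5Torus (IsPseudoDist SumBound)
open B4TorusKernel.MultiPeriod (torusSupNorm torusSupNorm_nonneg)
open B4Sect5Proof (latticeConst latticeConst_nonneg)
open B6LowerBound2153Torus (rep)
open B6BlockDecayCalculus (torusDist_isPseudoDist torusDist_sumBound)
open B6L2BlockCalculus (l2blk_adjoint)
open B6L2BlockGlobalNorm (norm_apply_le_of_l2blk)
open B6Prop25Grad2DecayTwoScaleV1 (l2blk_DDG_scaling adjoint_DDG_eq)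

variable {d L m K : ℕ} {hd : 1 ≤ d + 1} {hL : Odd L ∧ 1 < L} {j : ℕ}

open Classical in
/-- **[4] (1.89), THE GLOBAL MEMBER `‖∇_λ∇_μGJ‖ ≤ C‖J‖` FOR THE TWO-SCALE `G` OF (2.90)** (`c = L^j`, weights `a₀n^{d+1} ≤ w ≤ a₁n^{d+1}`): `∃ C ≥ 0`
depending on `d, L, a₀, a₁` only such that for every volume, `j + 1 ≤ m + K`, `Λ′`, weights in the window, directions `λ, μ` and every fine bond
field `J`: `‖∇_λ∇_μGJ‖ ≤ C‖J‖` (file 27's `ℓ²`-block bound summed over the blocks, file 23b).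
[cite: Balaban1984PropagatorsI, Prop. 1.1 (1.89) p.33; Balaban1984PropagatorsII, Prop. 2.5 p.246] -/
theorem prop25_ineq189_gradgrad (d L : ℕ) (hd : 1 ≤ d + 1) (hL : Odd L ∧ 1 < L) {a₀ a₁ : ℝ} (ha₀ : 0 < a₀) (ha₁ : a₀ ≤ a₁) :
    ∃ C : ℝ, 0 ≤ C ∧ ∀ (m K : ℕ) (j : ℕ) (hc : ((L : ℝ) ^ j) ≠ 0)
      (_hj : j + 1 ≤ (⟨d + 1, L, m, K, hd, hL⟩ : Params).m + (⟨d + 1, L, m, K, hd, hL⟩ : Params).K)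
      (Λ' : Finset (Site (⟨d + 1, L, m, K, hd, hL⟩ : Params) (j + 1))) (w : CIdx j Λ' → ℝ)
      (_hw0 : ∀ i, a₀ * ((L : ℝ) ^ j) ^ (d + 1) ≤ w i) (_hw1 : ∀ i, w i ≤ a₁ * ((L : ℝ) ^ j) ^ (d + 1)) (lam mu : Fin (d + 1))
      (J : BondSpace (⟨d + 1, L, m, K, hd, hL⟩ : Params)),
      ‖((((L : ℝ) ^ j) • (onE (LinearMap.funLeft ℝ ℝ (fun b : PBond (⟨d + 1, L, m, K, hd, hL⟩ : Params) 0 => (⟨b.src.shift lam, b.dir⟩ : PBond (⟨d + 1, L, m, K, hd, hL⟩ : Params) 0))) - LinearMap.id) : BondSpace (⟨d + 1, L, m, K, hd, hL⟩ : Params) →ₗ[ℝ] BondSpace (⟨d + 1, L, m, K, hd, hL⟩ : Params))) (((((L : ℝ) ^ j) • (onE (LinearMap.funLeft ℝ ℝ (fun b : PBond (⟨d + 1, L, m, K, hd, hL⟩ : Params) 0 => (⟨b.src.shift mu, b.dir⟩ : PBond (⟨d + 1, L, m, K, hd, hL⟩ : Params) 0))) - LinearMap.id) : BondSpace (⟨d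 + 1, L, m, K, hd, hL⟩ : Params) →ₗ[ℝ] BondSpace (⟨d + 1, L, m, K, hd, hL⟩ : Params))) ((tsV1 hc Λ' w).G J))‖ ≤ C * ‖J‖ := by
  obtain ⟨δ, hδ, C, hC, h⟩ := l2blk_DDG_scaling d L hd hL ha₀ ha₁
  refine ⟨C * latticeConst (d + 1) δ, mul_nonneg hC (latticeConst_nonneg _ hδ.le), ?_⟩
  intro m K j hc hj Λ' w hw0 hw1 lam mu J
  have hρ : IsPseudoDist (fun t t' : Site (⟨d + 1, L, m, K, hd, hL⟩ : Params) j => torusSupNorm (Mk (⟨d + 1, L, m, K, hd, hL⟩ : Params) j) (rep (Mk (⟨d + 1, L, m, K, hd, hL⟩ : Params) j) t - rep (Mk (⟨d + 1, L, m, K, hd, hL⟩ : Params) j) t')) := torusDist_isPseudoDist (Mk (⟨d + 1, L, m, K, hd, hL⟩ : Params) j)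
  have hK : SumBound (fun t t' : Site (⟨d + 1, L, m, K, hd, hL⟩ : Params) j => torusSupNorm (Mk (⟨d + 1, L, m, K, hd, hL⟩ : Params) j) (rep (Mk (⟨d + 1, L, m, K, hd, hL⟩ : Params) j) t - rep (Mk (⟨d + 1, L, m, K, hd, hL⟩ : Params) j) t')) (fun a => latticeConst (d + 1) a) := torusDist_sumBound (Mk (⟨d + 1, L, m, K, hd, hL⟩ : Params) j)
  exact norm_apply_le_of_l2blk hρ hK (((((L : ℝ) ^ j) • (onE (LinearMap.funLeft ℝ ℝ (fun b : PBond (⟨d + 1, L, m, K, hd, hL⟩ : Params) 0 => (⟨b.src.shift lam, b.dir⟩ : PBond (⟨d + 1, L, m, K, hd, hL⟩ : Params) 0))) - LinearMap.id) : BondSpace (⟨d + 1, L, m, K, hd, hL⟩ : Params) →ₗ[ℝ] BondSpace (⟨d + 1, L, m, K, hd, hL⟩ : Params))) ∘ₗ ((((L : ℝ) ^ j) • (onE (LinearMap.funLeft ℝ ℝ (fun b : PBond (⟨d + 1, L, m, K, hd, hL⟩ : Params) 0 => (⟨b.src.shift mu, b.dir⟩ : PBond (⟨d + 1, L, m, K,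 hd, hL⟩ : Params) 0))) - LinearMap.id) : BondSpace (⟨d + 1, L, m, K, hd, hL⟩ : Params) →ₗ[ℝ] BondSpace (⟨d + 1, L, m, K, hd, hL⟩ : Params))) ∘ₗ (tsV1 hc Λ' w).G) (fun b₀ : PBond (⟨d + 1, L, m, K, hd, hL⟩ : Params) 0 => iterBlockOf j b₀.src) (fun b₀ : PBond (⟨d + 1, L, m, K, hd, hL⟩ : Params) 0 => iterBlockOf j b₀.src) hC hδ (latticeConst_nonneg _ hδ.le)
    (h m K j hc hj Λ' w hw0 hw1 lam mu) J

open Classical in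
/-- **[4] (1.89), THE GLOBAL MEMBER `‖G∇_μ*∇_λ*J‖ ≤ C‖J‖` FOR THE TWO-SCALE `G` OF (2.90)** (by adjunction: `G* = G`, `(∇_λ∇_μG)* = G∇_μ*∇_λ*`; file
27's `adjoint_DDG_eq`, file 23's `l2blk_adjoint`, file 23b), same quantifiers as `prop25_ineq189_gradgrad`.
[cite: Balaban1984PropagatorsI, Prop. 1.1 (1.89) p.33; Balaban1984PropagatorsII, Prop. 2.5 p.246] -/
theorem prop25_ineq189_GDadjDadj (d L : ℕ) (hd : 1 ≤ d + 1) (hL : Odd L ∧ 1 < L) {a₀ a₁ : ℝ} (ha₀ : 0 < a₀) (ha₁ : a₀ ≤ a₁) :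
    ∃ C : ℝ, 0 ≤ C ∧ ∀ (m K : ℕ) (j : ℕ) (hc : ((L : ℝ) ^ j) ≠ 0)
      (_hj : j + 1 ≤ (⟨d + 1, L, m, K, hd, hL⟩ : Params).m + (⟨d + 1, L, m, K, hd, hL⟩ : Params).K)
      (Λ' : Finset (Site (⟨d + 1, L, m, K, hd, hL⟩ : Params) (j + 1))) (w : CIdx j Λ' → ℝ)
      (_hw0 : ∀ i, a₀ * ((L : ℝ) ^ j) ^ (d + 1) ≤ w i) (_hw1 : ∀ i, w i ≤ a₁ * ((L : ℝ) ^ j) ^ (d + 1)) (lam mu : Fin (d + 1))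
      (J : BondSpace (⟨d + 1, L, m, K, hd, hL⟩ : Params)),
      ‖(tsV1 hc Λ' w).G (((((L : ℝ) ^ j) • (onE (LinearMap.funLeft ℝ ℝ (fun b : PBond (⟨d + 1, L, m, K, hd, hL⟩ : Params) 0 => (⟨b.src.unshift mu, b.dir⟩ : PBond (⟨d + 1, L, m, K, hd, hL⟩ : Params) 0))) - LinearMap.id) : BondSpace (⟨d + 1, L, m, K, hd, hL⟩ : Params) →ₗ[ℝ] BondSpace (⟨d + 1, L, m, K, hd, hL⟩ : Params))) (((((L : ℝ) ^ j) • (onE (LinearMap.funLeft ℝ ℝ (fun b : PBond (⟨d + 1, L, m, K, hd, hL⟩ : Params) 0 => (⟨b.src.unshift lam, b.dir⟩ : PBond (⟨d + 1, L, m, K, hd, hL⟩ : Params) 0))) - LinearMap.id) : BondSpace (⟨d + 1, L, m, K, hd, hL⟩ : Params) →ₗ[ℝ] BondSpace (⟨d + 1, L, m, K, hd, hL⟩ : Params))) J))‖ ≤ C * ‖J‖ := by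
  obtain ⟨δ, hδ, C, hC, h⟩ := l2blk_DDG_scaling d L hd hL ha₀ ha₁
  refine ⟨C * latticeConst (d + 1) δ, mul_nonneg hC (latticeConst_nonneg _ hδ.le), ?_⟩
  intro m K j hc hj Λ' w hw0 hw1 lam mu J
  have hL0 : 0 < L := by have := hL.2; omega
  have hLp : (0 : ℝ) < L := by exact_mod_cast hL0
  have hw : ∀ i, 0 < w i := fun i => lt_of_lt_of_le (by positivity) (hw0 i)
  have hρ : IsPseudoDist (fun t t' : Site (⟨d + 1, L, m, K, hd, hL⟩ : Params) j => torusSupNorm (Mk (⟨d + 1, L, m, K, hd, hL⟩ : Params) j) (rep (Mk (⟨d + 1, L, m, K, hd, hL⟩ : Params) j) t - rep (Mk (⟨d + 1, L, m, K, hd, hL⟩ : Params) j) t')) := torusDist_isPseudoDist (Mk (⟨d + 1, L, m, K, hd, hL⟩ : Params) j)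
  have hK : SumBound (fun t t' : Site (⟨d + 1, L, m, K, hd, hL⟩ : Params) j => torusSupNorm (Mk (⟨d + 1, L, m, K, hd, hL⟩ : Params) j) (rep (Mk (⟨d + 1, L, m, K, hd, hL⟩ : Params) j) t - rep (Mk (⟨d + 1, L, m, K, hd, hL⟩ : Params) j) t')) (fun a => latticeConst (d + 1) a) := torusDist_sumBound (Mk (⟨d + 1, L, m, K, hd, hL⟩ : Params) j)
  have hadj := l2blk_adjoint hρ (((((L : ℝ) ^ j) • (onE (LinearMap.funLeft ℝ ℝ (fun b : PBond (⟨d + 1, L, m, K, hd, hL⟩ : Params) 0 => (⟨b.src.shift lam, b.dir⟩ : PBond (⟨d + 1, L, m, K, hd, hL⟩ : Params) 0))) - LinearMap.id) : BondSpace (⟨d + 1, L, m, K, hd, hL⟩ : Params) →ₗ[ℝ] BondSpace (⟨d + 1, L, m, K, hd, hL⟩ : Params))) ∘ₗ ((((L : ℝ) ^ j) • (onE (LinearMap.funLeft ℝ ℝ (fun b : PBond (⟨d + 1, L, m, K, hd, hL⟩ : Params) 0 => (⟨b.src.shift mu, b.dir⟩ : PBond (⟨d + 1, L, m, K, hd,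 hL⟩ : Params) 0))) - LinearMap.id) : BondSpace (⟨d + 1, L, m, K, hd, hL⟩ : Params) →ₗ[ℝ] BondSpace (⟨d + 1, L, m, K, hd, hL⟩ : Params))) ∘ₗ (tsV1 hc Λ' w).G) (fun b₀ : PBond (⟨d + 1, L, m, K, hd, hL⟩ : Params) 0 => iterBlockOf j b₀.src) (fun b₀ : PBond (⟨d + 1, L, m, K, hd, hL⟩ : Params) 0 => iterBlockOf j b₀.src) (h m K j hc hj Λ' w hw0 hw1 lam mu)
  rw [adjoint_DDG_eq hc hj Λ' hw lam mu] at hadj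
  exact norm_apply_le_of_l2blk hρ hK ((tsV1 hc Λ' w).G ∘ₗ ((((L : ℝ) ^ j) • (onE (LinearMap.funLeft ℝ ℝ (fun b : PBond (⟨d + 1, L, m, K, hd, hL⟩ : Params) 0 => (⟨b.src.unshift mu, b.dir⟩ : PBond (⟨d + 1, L, m, K, hd, hL⟩ : Params) 0))) - LinearMap.id) : BondSpace (⟨d + 1, L, m, K, hd, hL⟩ : Params) →ₗ[ℝ] BondSpace (⟨d + 1, L, m, K, hd, hL⟩ : Params))) ∘ₗ ((((L : ℝ) ^ j) • (onE (LinearMap.funLeft ℝ ℝ (fun b : PBond (⟨d + 1, L, m, K, hd, hL⟩ : Params) 0 => (⟨b.src.unshift lam, b.dir⟩ : PBond (⟨d + 1, L, m, K, hd, hL⟩ : Params) 0))) - LinearMap.id) : BondSpace (⟨d + 1, L, m, K, hd, hL⟩ : Params) →ₗ[ℝ] BondSpace (⟨d + 1, L, m, K, hd, hL⟩ : Params)))) (fun b₀ : PBond (⟨d + 1, L, m, K, hd, hL⟩ : Params) 0 => iterBlockOf j b₀.src) (fun b₀ : PBond (⟨d + 1, L, m, K, hd, hL⟩ : Params) 0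 => iterBlockOf j b₀.src) hC hδ (latticeConst_nonneg _ hδ.le) hadj J

end Literature.MathematicalPhysics.QuantumFieldTheory.Balaban1983to89.B6Prop25GlobalL2Grad2TwoScaleV1

end
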